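import Mathlib
import HarnessLib
import Summits.CriticalPhenomena.PercolationContinuityZ3.Theses.PercLowPointHalfSpace
import Summits.CriticalPhenomena.PercolationContinuityZ3.Theorems.PercLowPointHalfSpaceAssemblyColumnTelescoping
import Summits.CriticalPhenomena.PercolationContinuityZ3.Theorems.PercLowPointHalfSpaceLowPointBookkeepingStubPivotTranslation
import Summits.CriticalPhenomena.PercolationContinuityZ3.Theorems.PercLowPointHalfSpaceLowPointBookkeepingStubDilutionToolkit
import Summits.CriticalPhenomena.PercolationContinuityZ3.Theorems.PercLowPointHalfSpaceLowPointBookkeepingStubPairCount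
import Summits.CriticalPhenomena.PercolationContinuityZ3.Theorems.PercLowPointHalfSpaceLowPointBookkeepingStubPairExpectation
import Summits.CriticalPhenomena.PercolationContinuityZ3.Theorems.PercLowPointHalfSpaceLowPointBookkeepingStubFloorCoupling
import Literature.Probability.Percolation.HalfSpaceFloorDilution

/-!
# Glue of line SketchIdeator1 (floor-russo) for the crux `LowPointBookkeeping` — (1/2) window bound

Crux item `stmt-CriticalPhenomena-14713`,
`K := Summit.CriticalPhenomena.PercolationContinuityZ3.Theses.PercLowPointHalfSpace.LowPointBookkeeping`
(`BoundaryTwoArmDecay → TallClusterMassBound → QuantitativeBGN → [P_{p_c}(0 ↔ n e₀) → 0]`).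

This file and its sequel `…LowPointBookkeepingOfSharpStubs.lean` are the sorry-free COMPOSITION of
the line (crux work files `Cruxes/LowPointBookkeeping/Lines/SketchIdeator1.{lean,md}`), with the
line's two OPEN registered stubs turned into explicit hypotheses (they are new hypotheses —
critical-exponent bounds at `p_c(ℤ³)` — not lemmas):

* **(A♯ₛ)** `hA` — under the floor-diluted critical half-space measure `P^{ℍ}_{p_c,s}`
  (`floorDilutedPercolation 3 (criticalProbI 3) s`), uniformly in the floor density `s ∈ [0,1]` and in
  the four floor neighbours `e` of `0`: the probability that `C_ℍ(0)` and `C_ℍ(e)` are ℍ-disjoint and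
  both reach sup-distance `r` is `≤ C r^{-(11/4+κ)}` for some `κ > 0`
  (verbatim the registered stub `stub_twoArmSharpFloor`);
* **(B♯)** `hB` — at `s = 1` (bond percolation on the induced half-space graph), for the half-boxes
  `(x + B_n) ∩ ℍ` at `0` and at its four floor neighbours, the largest cluster trace has
  `≥ C n^{11/4}` vertices with probability `≤ 1/e` (verbatim the registered stub `stub_noFatHalfBox`).

Main result here: `exists_windowSum_bound : (A♯ₛ) → (B♯) → ∃ κ > 0, C ≥ 0, ∀ L ≥ 1,
Σ_{w ∈ W_L} P_{p_c}(0 ↔ w) ≤ |W_L| · P_{p_c}(arm_ℍ(0,L)) + 4 C L^{3-κ/2}` for the window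
`W_L = B_L + 2L e₀`.  Steps: column telescoping
`τ(0,w) = τ_ℍ(0,w) + Σ_t [τ_ℍ − τ_{ℍ₊}]((t+1)e₀, w + (t+1)e₀)` (`LowPoint.measure_openConn_eq_column_add_tsum`);
floor term `{0 ↔_ℍ w} ⊆ arm_ℍ(0,L)` for `w₀ ≥ L`; the integrated Russo inequality in the floor density
(`stub_floorCoupling`, landed); horizontal translation (`stub_pivotTranslation`, landed); window sum;
deterministic dyadic pair count (`stub_pairCount`, landed) and Markov truncation
(`stub_pairExpectation`, landed) fed by (A♯ₛ) and by the exponential mass tails that (B♯) yields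
through Hutchcroft's universal tightness (`stub_dilutionToolkit`, landed).
-/

noncomputable section

open MeasureTheory Filter Topology
open Literature.Probability.Percolation Literature.Probability.LatticeModels
open scoped ENNReal

namespace Summit.CriticalPhenomena.PercolationContinuityZ3.Theorems.FloorRusso.Glue

open Summit.CriticalPhenomena.PercolationContinuityZ3.Theses.PercLowPointHalfSpace
open Summit.CriticalPhenomena.PercolationContinuityZ3.Theorems.FloorRusso.Coupling
  (HS HP pivAt measurableSet_pivAt μH)

/-- The critical bond percolation measure on `ℤ³` (local notation). -/
local notation3 (prettyPrint := false) "μc" =>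
  (bondPercolation (zdGraph 3) (criticalProbI 3) : Measure (BondConfig (Site 3)))

/-- The window `W_L = B_L + 2L e₀` (local notation). -/
local notation3 (prettyPrint := false) "𝑾⟦" L "⟧" =>
  ((box 3 L).image fun y : Site 3 => y + Pi.single 0 (((2 * L : ℕ)) : ℤ))

/-- The boundary one-arm event `arm_ℍ(0, r)` (verbatim the route's; local notation). -/
local notation3 (prettyPrint := false) "𝑻⟦" r "⟧" =>
  ({ω | ∃ y : Site 3, (∃ i : Fin 3, ((r : ℕ) : ℤ) ≤ |y i|) ∧ ω ∈ openConnIn HS 0 y} :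
    Set (BondConfig (Site 3)))

/-- The height `t + 1` point of the normal axis (local notation). -/
local notation3 (prettyPrint := false) "𝒂⟦" t "⟧" => (Pi.single 0 ((t : ℤ) + 1) : Site 3)

/-- Hypothesis (A♯ₛ): the registered stub `stub_twoArmSharpFloor`, verbatim (local notation). -/
local notation3 (prettyPrint := false) "SharpFloorTwoArm" =>
  (∃ κ C : ℝ, 0 < κ ∧ ∀ s : unitInterval, ∀ e ∈ ({Pi.single 1 1, Pi.single 1 (-1), Pi.single 2 1, Pi.single 2 (-1)} : Finset (Site 3)), ∀ r : ℕ, 1 ≤ r →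
      (floorDilutedPercolation 3 (criticalProbI 3) s).real
        ({ω | ∃ y : Site 3, (∃ i : Fin 3, ((r : ℕ) : ℤ) ≤ |y i|) ∧ ω ∈ openConnIn {x : Site 3 | 0 ≤ x 0} 0 y} ∩ {ω | ∃ y : Site 3, (∃ i : Fin 3, ((r : ℕ) : ℤ) ≤ |y i - e i|) ∧ ω ∈ openConnIn {x : Site 3 | 0 ≤ x 0} e y} ∩ (openConnIn {x : Site 3 | 0 ≤ x 0} 0 e)ᶜ) ≤ C * (r : ℝ) ^ (-(11 / 4 + κ)) : Prop)

/-- Hypothesis (B♯): the registered stub `stub_noFatHalfBox`, verbatim (local notation). -/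
local notation3 (prettyPrint := false) "NoFatHalfBox" =>
  (∃ C : ℝ, 0 < C ∧ ∀ x ∈ insert (0 : Site 3) ({Pi.single 1 1, Pi.single 1 (-1), Pi.single 2 1, Pi.single 2 (-1)} : Finset (Site 3)), ∀ n : ℕ, 1 ≤ n →
      (floorDilutedPercolation 3 (criticalProbI 3) 1).real
        {ω | C * (n : ℝ) ^ ((11 : ℝ) / 4) ≤ (clusterMaxIn (((box 3 n).image fun y : Site 3 => x + y).filter fun z : Site 3 => 0 ≤ z 0) ω : ℝ)}
          ≤ Real.exp (-1) : Prop)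

/-! ### Elementary facts -/

/-- `(𝒂⟦t⟧)₀ = t + 1`. -/
theorem ax_zero (t : ℕ) : (𝒂⟦t⟧) 0 = (t : ℤ) + 1 := by simp

/-- `1 ≤ (𝒂⟦t⟧)₀`. -/
theorem one_le_ax_zero (t : ℕ) : 1 ≤ (𝒂⟦t⟧) 0 := by rw [ax_zero]; omega

/-- Points of the window have height `≥ L`. -/
theorem window_zero_ge {L : ℕ} {w : Site 3} (hw : w ∈ 𝑾⟦L⟧) : (L : ℤ) ≤ w 0 := by
  simp only [Finset.mem_image, mem_box] at hw
  obtain ⟨y, hy, rfl⟩ := hw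
  have h := (hy 0).1
  simp only [Pi.add_apply, Pi.single_eq_same]
  push_cast
  omega

/-- `|W_L| = (2L+1)³`. -/
theorem card_window (L : ℕ) : (𝑾⟦L⟧).card = (2 * L + 1) ^ 3 := by
  rw [Finset.card_image_of_injective _ (add_left_injective _), card_box]

/-- `s ↦ P_s(pivAt x x' a b)` is measurable. -/
theorem measurable_μH_pivAt (x x' a b : Site 3) :
    Measurable fun s : unitInterval => μH s (pivAt x x' a b) :=
  measurable_floorDilutedPercolation_apply _ (measurableSet_pivAt x x' a b)

/-- Preimage form of the horizontal shift invariance (from the map form of the toolkit). -/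
theorem μH_preimage_shift
    (hmap : ∀ s : unitInterval, ∀ z : Site 3, z 0 = 0 →
      (μH s).map (BondConfig.relabel (sym2Equiv (Site.shift z))) = μH s)
    (s : unitInterval) (z : Site 3) (hz : z 0 = 0) (S : Set (BondConfig (Site 3))) :
    μH s ((BondConfig.relabel (sym2Equiv (Site.shift z))) ⁻¹' S) = μH s S := by
  rw [← MeasurableEquiv.map_apply, hmap s z hz]

/-! ### Steps 1–3: column events, transfer to the half-space measure, coupling -/

/-- `{0 ↔_ℍ w} ⊆ arm_ℍ(0, L)` for `w` in the window. -/
theorem openConnIn_subset_tall0 {L : ℕ} {w : Site 3} (hw : w ∈ 𝑾⟦L⟧) :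
    (openConnIn HS 0 w : Set (BondConfig (Site 3))) ⊆ 𝑻⟦L⟧ := by
  intro ω hω
  refine ⟨w, ⟨0, ?_⟩, hω⟩
  have h := window_zero_ge hw
  exact h.trans (le_abs_self _)

/-- One column event is bounded by the integrated pivotal-pair probabilities
(the landed integrated Russo inequality `stub_floorCoupling`, transferred from `P_{p_c}` to
`P^{ℍ}_{p_c,1}` on `openConnIn` events). -/
theorem measure_columnEvent_le (t : ℕ) (w : Site 3) (hw : 0 ≤ w 0) :
    μc (openConnIn HS (𝒂⟦t⟧) (w + 𝒂⟦t⟧) \ openConnIn HP (𝒂⟦t⟧) (w + 𝒂⟦t⟧)) ≤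
      ∑' x : {x : Site 3 // x 0 = 0}, ∑ e ∈ Coupling.nbrs,
        ∫⁻ s : unitInterval, μH s (pivAt (x : Site 3) ((x : Site 3) + e) (𝒂⟦t⟧) (w + 𝒂⟦t⟧)) := by
  have hsub : (openConnIn HP (𝒂⟦t⟧) (w + 𝒂⟦t⟧) : Set (BondConfig (Site 3))) ⊆
      openConnIn HS (𝒂⟦t⟧) (w + 𝒂⟦t⟧) :=
    LowPoint.openConnIn_upper_subset_halfSpace _ _
  rw [measure_sdiff_le_iff_le_add (measurableSet_openConnIn_of_countable _ _ _).nullMeasurableSet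
    hsub (measure_ne_top _ _)]
  have hb : 1 ≤ (w + 𝒂⟦t⟧) 0 := by
    simp only [Pi.add_apply, ax_zero]; omega
  have h1 : μc (openConnIn HS (𝒂⟦t⟧) (w + 𝒂⟦t⟧)) = μH 1 (openConnIn HS (𝒂⟦t⟧) (w + 𝒂⟦t⟧)) :=
    (floorDilutedPercolation_one_openConnIn (criticalProbI 3) subset_rfl _ _).symm
  have h2 : μc (openConnIn HP (𝒂⟦t⟧) (w + 𝒂⟦t⟧)) = μH 1 (openConnIn HP (𝒂⟦t⟧) (w + 𝒂⟦t⟧)) :=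
    (floorDilutedPercolation_one_openConnIn (criticalProbI 3)
      (fun x (hx : 1 ≤ x 0) => (show (0 : ℤ) ≤ x 0 by omega)) _ _).symm
  rw [h1, h2]
  exact stub_floorCoupling (𝒂⟦t⟧) (w + 𝒂⟦t⟧) (one_le_ax_zero t) hb

/-- The column sum is bounded by the integrated cross-pair sums (coupling + translation + Tonelli). -/
theorem tsum_columnEvent_le (hmap : ∀ s : unitInterval, ∀ z : Site 3, z 0 = 0 →
      (μH s).map (BondConfig.relabel (sym2Equiv (Site.shift z))) = μH s)
    (w : Site 3) (hw : 0 ≤ w 0) :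
    ∑' t : ℕ, μc (openConnIn HS (𝒂⟦t⟧) (w + 𝒂⟦t⟧) \ openConnIn HP (𝒂⟦t⟧) (w + 𝒂⟦t⟧)) ≤
      ∑ e ∈ Coupling.nbrs, ∫⁻ s : unitInterval,
        ∑' v : {v : Site 3 // 1 ≤ v 0}, μH s (pivAt 0 e (v : Site 3) ((v : Site 3) + w)) := by
  calc ∑' t : ℕ, μc (openConnIn HS (𝒂⟦t⟧) (w + 𝒂⟦t⟧) \ openConnIn HP (𝒂⟦t⟧) (w + 𝒂⟦t⟧))
      ≤ ∑' t : ℕ, ∑' x : {x : Site 3 // x 0 = 0}, ∑ e ∈ Coupling.nbrs,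
          ∫⁻ s : unitInterval, μH s (pivAt (x : Site 3) ((x : Site 3) + e) (𝒂⟦t⟧) (w + 𝒂⟦t⟧)) :=
        ENNReal.tsum_le_tsum fun t => measure_columnEvent_le t w hw
    _ = ∑ e ∈ Coupling.nbrs, ∑' t : ℕ, ∑' x : {x : Site 3 // x 0 = 0},
          ∫⁻ s : unitInterval, μH s (pivAt (x : Site 3) ((x : Site 3) + e) (𝒂⟦t⟧) (w + 𝒂⟦t⟧)) := by
        rw [← Summable.tsum_finsetSum fun _ _ => ENNReal.summable]
        refine tsum_congr fun t => ?_
        exact Summable.tsum_finsetSum fun _ _ => ENNReal.summable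
    _ = ∑ e ∈ Coupling.nbrs, ∫⁻ s : unitInterval, ∑' t : ℕ, ∑' x : {x : Site 3 // x 0 = 0},
          μH s (pivAt (x : Site 3) ((x : Site 3) + e) (𝒂⟦t⟧) (w + 𝒂⟦t⟧)) := by
        refine Finset.sum_congr rfl fun e _ => ?_
        rw [lintegral_tsum fun t => ?_]
        · refine tsum_congr fun t => ?_
          rw [lintegral_tsum fun x => (measurable_μH_pivAt _ _ _ _).aemeasurable]
        · exact (Measurable.tsum fun x => measurable_μH_pivAt _ _ _ _).aemeasurable
    _ ≤ ∑ e ∈ Coupling.nbrs, ∫⁻ s : unitInterval,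
          ∑' v : {v : Site 3 // 1 ≤ v 0}, μH s (pivAt 0 e (v : Site 3) ((v : Site 3) + w)) := by
        refine Finset.sum_le_sum fun e he => lintegral_mono fun s => ?_
        exact stub_pivotTranslation s e w (Coupling.nbrs_floor e he)
          (fun z hz S _ => μH_preimage_shift hmap s z hz S)

/-! ### Steps 4–5: window sum -/

/-- The window sum of the two-point function: floor part + cross part. -/
theorem windowSum_le (hmap : ∀ s : unitInterval, ∀ z : Site 3, z 0 = 0 →
      (μH s).map (BondConfig.relabel (sym2Equiv (Site.shift z))) = μH s) (L : ℕ) :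
    ∑ w ∈ 𝑾⟦L⟧, μc (openConn (0 : Site 3) w) ≤
      (𝑾⟦L⟧).card * μc (𝑻⟦L⟧) +
        ∑ e ∈ Coupling.nbrs, ∫⁻ s : unitInterval, ∑ w ∈ 𝑾⟦L⟧,
          ∑' v : {v : Site 3 // 1 ≤ v 0}, μH s (pivAt 0 e (v : Site 3) ((v : Site 3) + w)) := by
  have hcol : ∀ w ∈ 𝑾⟦L⟧, μc (openConn (0 : Site 3) w) ≤ μc (𝑻⟦L⟧) +
      ∑ e ∈ Coupling.nbrs, ∫⁻ s : unitInterval,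
        ∑' v : {v : Site 3 // 1 ≤ v 0}, μH s (pivAt 0 e (v : Site 3) ((v : Site 3) + w)) := by
    intro w hw
    have hw0 : 0 ≤ w 0 := le_trans (by positivity) (window_zero_ge hw)
    rw [LowPoint.measure_openConn_eq_column_add_tsum (criticalProbI 3) w]
    exact add_le_add (measure_mono (openConnIn_subset_tall0 hw)) (tsum_columnEvent_le hmap w hw0)
  refine (Finset.sum_le_sum hcol).trans (le_of_eq ?_)
  rw [Finset.sum_add_distrib, Finset.sum_const, nsmul_eq_mul, Finset.sum_comm]
  congr 1
  refine Finset.sum_congr rfl fun e _ => ?_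
  rw [lintegral_finsetSum _ fun w _ => ?_]
  exact Measurable.tsum fun v => measurable_μH_pivAt _ _ _ _

/-- **The pair inputs**: from (A♯ₛ) and (B♯), constants `κ ∈ (0, 1/4]` and `C ≥ 0` such that,
uniformly in the floor density and the neighbour, the expected window pair count is `≤ C L^{3-κ/2}`
(toolkit, pair count and pair expectation are the landed stubs). -/
theorem exists_pairBound (hA : SharpFloorTwoArm) (hB : NoFatHalfBox) :
    ∃ κ C : ℝ, 0 < κ ∧ 0 ≤ C ∧ ∀ s : unitInterval, ∀ e ∈ Coupling.nbrs, ∀ L : ℕ, 1 ≤ L →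
      ∑ w ∈ 𝑾⟦L⟧, ∑' v : {v : Site 3 // 1 ≤ v 0},
          μH s (pivAt 0 e (v : Site 3) ((v : Site 3) + w)) ≤
        ENNReal.ofReal (C * (L : ℝ) ^ (3 - κ / 2)) := by
  obtain ⟨κ₀, C₀, hκ₀, hA⟩ := hA
  obtain ⟨Cb, hCb, hB⟩ := hB
  obtain ⟨hmap, htail⟩ := stub_dilutionToolkit
  have hT := htail Cb hCb hB
  set κ : ℝ := min κ₀ (1 / 4) with hκdef
  set C₁ : ℝ := max C₀ 0 with hC₁def
  have hκ : 0 < κ := lt_min hκ₀ (by norm_num)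
  have hκle : κ ≤ 1 / 4 := min_le_right _ _
  have hC₁ : 0 ≤ C₁ := le_max_right _ _
  have hC₂ : 0 < Cb + 1 := by linarith
  obtain ⟨C, hC⟩ := stub_pairExpectation κ C₁ (Cb + 1) hκ hκle hC₁ hC₂ stub_pairCount
  refine ⟨κ, max C 0, hκ, le_max_right _ _, fun s e he L hL => ?_⟩
  have hA' : ∀ r : ℕ, 1 ≤ r → (μH s).real
      ({ω | ∃ y : Site 3, (∃ i : Fin 3, ((r : ℕ) : ℤ) ≤ |y i|) ∧ ω ∈ openConnIn HS 0 y} ∩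
        {ω | ∃ y : Site 3, (∃ i : Fin 3, ((r : ℕ) : ℤ) ≤ |y i - e i|) ∧ ω ∈ openConnIn HS e y} ∩
        (openConnIn HS 0 e)ᶜ) ≤ C₁ * (r : ℝ) ^ (-(11 / 4 + κ)) := by
    intro r hr
    refine (hA s e he r hr).trans ?_
    have hr1 : (1 : ℝ) ≤ r := by exact_mod_cast hr
    have hpow : (r : ℝ) ^ (-(11 / 4 + κ₀)) ≤ (r : ℝ) ^ (-(11 / 4 + κ)) :=
      Real.rpow_le_rpow_of_exponent_le hr1 (by linarith [min_le_left κ₀ (1 / 4)])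
    calc C₀ * (r : ℝ) ^ (-(11 / 4 + κ₀)) ≤ C₁ * (r : ℝ) ^ (-(11 / 4 + κ₀)) :=
          mul_le_mul_of_nonneg_right (le_max_left _ _) (by positivity)
      _ ≤ C₁ * (r : ℝ) ^ (-(11 / 4 + κ)) := mul_le_mul_of_nonneg_left hpow hC₁
  have hT' : ∀ x ∈ ({0, e} : Finset (Site 3)), ∀ n : ℕ, 1 ≤ n → ∀ t : ℝ, 1 ≤ t →
      (μH s).real {ω | t * ((Cb + 1) * (n : ℝ) ^ ((11 : ℝ) / 4)) ≤
        (((↑(box 3 n) : Set (Site 3)) ∩ {y : Site 3 | ω ∈ openConnIn HS x (x + y)}).ncard : ℝ)} ≤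
        Real.exp (3 / 2) * Real.exp (-t / 2) := by
    intro x hx
    have hx' : x ∈ insert (0 : Site 3) Coupling.nbrs := by
      simp only [Finset.mem_insert, Finset.mem_singleton] at hx
      rcases hx with rfl | rfl
      · exact Finset.mem_insert_self _ _
      · exact Finset.mem_insert_of_mem he
    exact hT s x hx'
  refine (hC s e he hA' hT' L hL).trans (ENNReal.ofReal_le_ofReal ?_)
  exact mul_le_mul_of_nonneg_right (le_max_left _ _) (by positivity)

/-- **Window sum bound**: `Σ_{w ∈ W_L} τ(0,w) ≤ |W_L| π_s(L) + 4 C L^{3-κ/2}` (in `ℝ≥0∞`). -/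
theorem exists_windowSum_bound (hA : SharpFloorTwoArm) (hB : NoFatHalfBox) :
    ∃ κ C : ℝ, 0 < κ ∧ 0 ≤ C ∧ ∀ L : ℕ, 1 ≤ L →
      ∑ w ∈ 𝑾⟦L⟧, μc (openConn (0 : Site 3) w) ≤
        (𝑾⟦L⟧).card * μc (𝑻⟦L⟧) + Coupling.nbrs.card * ENNReal.ofReal (C * (L : ℝ) ^ (3 - κ / 2)) := by
  obtain ⟨κ, C, hκ, hC, hpair⟩ := exists_pairBound hA hB
  obtain ⟨hmap, -⟩ := stub_dilutionToolkit
  refine ⟨κ, C, hκ, hC, fun L hL => (windowSum_le hmap L).trans (add_le_add le_rfl ?_)⟩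
  refine (Finset.sum_le_sum fun e he => lintegral_mono fun s => hpair s e he L hL).trans (le_of_eq ?_)
  rw [lintegral_const, measure_univ, mul_one, Finset.sum_const, nsmul_eq_mul]

/-- **Registered wrapper `stub_glueWindowBound`** (def-free signature, registered on the crux item):
(A♯ₛ) → (B♯) → the window-sum bound, verbatim `exists_windowSum_bound`. -/
theorem stub_glueWindowBound : (∃ κ C : ℝ, 0 < κ ∧ ∀ s : unitInterval, ∀ e ∈ ({Pi.single 1 1, Pi.single 1 (-1), Pi.single 2 1, Pi.single 2 (-1)} : Finset (Site 3)), ∀ r : ℕ, 1 ≤ r → (floorDilutedPercolation 3 (criticalProbI 3) s).real ({ω | ∃ y : Site 3, (∃ i : Fin 3, ((r : ℕ) : ℤ) ≤ |y i|) ∧ ω ∈ openConnIn {x : Site 3 | 0 ≤ x 0} 0 y} ∩ {ω | ∃ y : Site 3, (∃ i : Fin 3, ((r : ℕ) : ℤ) ≤ |y i - e i|) ∧ ω ∈ openConnIn {x : Site 3 | 0 ≤ x 0} e y} ∩ (openConnIn {x : Site 3 | 0 ≤ x 0} 0 e)ᶜ) ≤ C * (r : ℝ) ^ (-(11 / 4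 + κ))) → (∃ C : ℝ, 0 < C ∧ ∀ x ∈ insert (0 : Site 3) ({Pi.single 1 1, Pi.single 1 (-1), Pi.single 2 1, Pi.single 2 (-1)} : Finset (Site 3)), ∀ n : ℕ, 1 ≤ n → (floorDilutedPercolation 3 (criticalProbI 3) 1).real {ω | C * (n : ℝ) ^ ((11 : ℝ) / 4) ≤ (clusterMaxIn (((box 3 n).image fun y : Site 3 => x + y).filter fun z : Site 3 => 0 ≤ z 0) ω : ℝ)} ≤ Real.exp (-1)) → ∃ κ C : ℝ, 0 < κ ∧ 0 ≤ C ∧ ∀ L : ℕ, 1 ≤ L → ∑ w ∈ ((box 3 L).image fun y : Site 3 => y + Pi.single 0 (((2 * L : ℕ)) : ℤ)), bondPercolation (zdGraph 3) (criticalProbI 3) (openConn (0 : Site 3) w) ≤ (((box 3 L).image fun y : Site 3 => y + Pi.single 0 (((2 * L : ℕ)) : ℤ)).card : ENNReal) * bondPercolation (zdGraph 3) (criticalProbI 3) {ω | ∃ y : Site 3, (∃ i : Fin 3, ((L : ℕ) : ℤ) ≤ |y i|) ∧ ω ∈ openConnIn {x : Site 3 | 0 ≤ x 0} 0 y} + (({Pi.single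 1 1, Pi.single 1 (-1), Pi.single 2 1, Pi.single 2 (-1)} : Finset (Site 3)).card : ENNReal) * ENNReal.ofReal (C * (L : ℝ) ^ (3 - κ / 2)) :=
  fun hA hB => exists_windowSum_bound hA hB

end Summit.CriticalPhenomena.PercolationContinuityZ3.Theorems.FloorRusso.Glue

end
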